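import Summits.Ventures.HSemireg.ObstructionLocusCrossingTFree

/-!
# Venture HSemireg — (S5) OBSTRUCTION LOCUS away from secant type, XL: the Hilbert–Burch complex of a block MODULO THE
# VARIABLES OF THE OTHER BLOCKS — `I_S ⊗ R̄ = R̄^S ⧸ Φ̄` keeps its syzygies, and THE CORE of EXT-NOTE §6.B(c) in a
# middle degree: `ker(Φᵀ on (R̄^S ⧸ Φ̄)-valued vectors) ≃ₗ[R] R̄`, `R̄ = R ⧸ (x_t : t ∈ T)`, `S ∩ T = ∅`

HONEST FRAMING.  Part of the Lean side of the computation cell `pub-hsemireg` (track «S4-PUSH» (ii), seat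
s4-prove-2).  Plain commutative algebra in `R = MvPolynomial (Fin n) K`, every `n`, EVERY commutative ring `K`, on top
of files XXVI/XXXII (first syzygies of `(x_{S∖a})_a`, `hbMatrix`, `blockGenMap`) and XXXIX (`T`-free representatives).
Nothing here constructs a variety or a sheaf; nothing here says that HC / HC_CM / HC_AV holds; no Literature fact is
declared or used; no object is certified.

CONTENT.  For a block `S`, `a₀ ∈ S`, and a set of coordinates `T` with `S ∩ T = ∅`, `J = (x_t : t ∈ T)`, `R̄ = R ⧸ J`,
`Φ̄ = Φ ⊗ R̄` (file XXXII's scalar matrix `hbMatrix S a₀` on `R̄`-valued vectors):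
* `genMapQuot` (`ḡs : R̄^S → R̄`, `w ↦ Σ_a x_{S∖a} • w_a`), `genMapQuot_mkQ`, `scalarMatrix_mkQ`, `genMapQuot_scalarMatrix`
  (`ḡs ∘ Φ̄ = 0`), **`exists_scalarMatrix_eq_of_genMapQuot_eq_zero`** (`ker ḡs = range Φ̄`: the first syzygies of file
  XXVI survive reduction modulo `J` — reduce a relation to `T`-free representatives; a `T`-free element of `J` is `0`);
* `sum_hbMatrix_transpose_smul` (the columns of `Φᵀ`), **`exists_eq_sq_mul_of_transpose_rel`** (`x_b Σ_b = x_{a₀} Σ_{a₀}`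
  for all `b` forces `Σ_a = x_{S∖a} · r`, over `R`);
* `quotCokernel` (`C = R̄^S ⧸ range Φ̄ = I_S ⊗ R̄`), `transposeOnCokernel` (`Φᵀ` on `C`-valued vectors), `coreMidMap`
  (`p̄ ↦ (a ↦ [p̄ e_a])`), `transposeOnCokernel_coreMidMap`, `coreMidMap_injective`, `exists_coreMidMap_eq`, and THE CORE
  **`kerTransposeEquiv : R̄ ≃ₗ[R] ker(Φᵀ on C-valued vectors)`** — in words `ker(Φᵀ ⊗ 1 on (I_S ⊗ R̄)^S) =
  Hom_R(I_S, I_S) ⊗ R̄ = R̄`: the Hom-dual of the Hilbert–Burch presentation of `I_S` stays exact at its left end after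
  reduction modulo the variables of the other blocks (the Tor-independence input of §6.B(c), by hand).
References (dictionary only): EXT-NOTE.md §6.A, §6.B(c).
-/

open MvPolynomial Finset
open scoped BigOperators

universe u

namespace Summit.Ventures.HSemireg.ObstructionLocus.BlockModel

variable {K : Type u} [CommRing K] {n : ℕ}

/-! ## The Hilbert–Burch complex of `S` modulo `J = (x_t : t ∈ T)`, `S ∩ T = ∅` -/

section Core

variable (S : Finset (Fin n)) {a₀ : Fin n} (T : Finset (Fin n))

/-- `ḡs : R̄^S →ₗ[R] R̄`, `w ↦ Σ_a x_{S∖a} • w_a` (file XXVI's `blockGenMap` modulo `J`, landing in `R̄`). -/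
noncomputable def genMapQuot :
    (↥S → MvPolynomial (Fin n) K ⧸ varIdeal K T) →ₗ[MvPolynomial (Fin n) K] (MvPolynomial (Fin n) K ⧸ varIdeal K T) :=
  ∑ a : ↥S, (sq (S.erase a.1) : MvPolynomial (Fin n) K) • (LinearMap.proj a)

/-- The formula for `ḡs`. -/
theorem genMapQuot_apply (w : ↥S → MvPolynomial (Fin n) K ⧸ varIdeal K T) :
    genMapQuot S T w = ∑ a : ↥S, (sq (S.erase a.1) : MvPolynomial (Fin n) K) • w a := by
  simp [genMapQuot, LinearMap.sum_apply]

/-- `ḡs` on classes of `R`-valued vectors is the class of `blockGenMap`. -/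
theorem genMapQuot_mkQ (c : ↥S → MvPolynomial (Fin n) K) :
    genMapQuot S T (fun a => Ideal.Quotient.mk (varIdeal K T) (c a)) =
      Ideal.Quotient.mk (varIdeal K T) (blockGenMap S c : MvPolynomial (Fin n) K) := by
  rw [genMapQuot_apply, blockGenMap_apply_coe, map_sum]
  refine Finset.sum_congr rfl fun a _ => ?_
  rw [smul_mk_eq, mul_comm]

/-- The scalar matrix `Φ̄` on `R̄`-valued vectors of classes is the class of `Φ` on `R`-valued vectors. -/
theorem scalarMatrix_mkQ {T₁ T₂ : Type} [Fintype T₁] (c : T₂ → T₁ → MvPolynomial (Fin n) K)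
    (W : T₁ → MvPolynomial (Fin n) K) :
    scalarMatrix (MvPolynomial (Fin n) K ⧸ varIdeal K T) c (fun a => Ideal.Quotient.mk (varIdeal K T) (W a)) =
      fun b => Ideal.Quotient.mk (varIdeal K T) (scalarMatrix (MvPolynomial (Fin n) K) c W b) := by
  funext b
  rw [scalarMatrix_apply, scalarMatrix_apply, map_sum]
  refine Finset.sum_congr rfl fun a _ => ?_
  rw [smul_mk_eq, smul_eq_mul]

/-- `ḡs ∘ Φ̄ = 0`. -/
theorem genMapQuot_scalarMatrix (ha₀ : a₀ ∈ S) (w : ↥(S.erase a₀) → MvPolynomial (Fin n) K ⧸ varIdeal K T) :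
    genMapQuot S T (scalarMatrix (MvPolynomial (Fin n) K ⧸ varIdeal K T) (hbMatrix (K := K) S a₀) w) = 0 := by
  have hW : ∀ b, ∃ g, Ideal.Quotient.mk (varIdeal K T) g = w b := fun b => Ideal.Quotient.mk_surjective (w b)
  choose W hW using hW
  have hw : w = fun b => Ideal.Quotient.mk (varIdeal K T) (W b) := funext fun b => (hW b).symm
  rw [hw, scalarMatrix_mkQ, genMapQuot_mkQ, blockGenMap_scalarMatrix_hbMatrix ha₀, Submodule.coe_zero, map_zero]

/-- **Exactness modulo `J`**: `ker ḡs ≤ range Φ̄` — the first syzygies of `(x_{S∖a})_a` (file XXVI) survive reduction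
modulo the variables `T`, `S ∩ T = ∅` (reduce a relation to `T`-free representatives; a `T`-free element of `J` is `0`). -/
theorem exists_scalarMatrix_eq_of_genMapQuot_eq_zero (ha₀ : a₀ ∈ S) (hST : ∀ a ∈ S, a ∉ T)
    (w : ↥S → MvPolynomial (Fin n) K ⧸ varIdeal K T) (hw : genMapQuot S T w = 0) :
    ∃ w' : ↥(S.erase a₀) → MvPolynomial (Fin n) K ⧸ varIdeal K T,
      scalarMatrix (MvPolynomial (Fin n) K ⧸ varIdeal K T) (hbMatrix (K := K) S a₀) w' = w := by
  have hW : ∀ a, ∃ g : MvPolynomial (Fin n) K, (∀ e ∈ g.support, ¬ Touches T e) ∧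
      Ideal.Quotient.mk (varIdeal K T) g = w a := fun a => exists_tfree_rep T (w a)
  choose W hWfree hW using hW
  have hw' : w = fun a => Ideal.Quotient.mk (varIdeal K T) (W a) := funext fun a => (hW a).symm
  -- the relation lifts to `R`
  have hrel : (blockGenMap S W : MvPolynomial (Fin n) K) = 0 := by
    apply eq_zero_of_tfree_of_mem T
    · rw [blockGenMap_apply_coe]
      exact tfree_sum T _ _ fun a _ => tfree_mul T (hWfree a)
        (tfree_sq T fun u hu => hST u (Finset.mem_of_mem_erase hu))
    · rw [← Ideal.Quotient.eq_zero_iff_mem, ← genMapQuot_mkQ, ← hw', hw]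
  have hker : blockGenMap S W = 0 := Subtype.ext hrel
  obtain ⟨W', hW'⟩ := ((exact_scalarMatrix_hbMatrix_blockGenMap (K := K) ha₀) W).1 hker
  refine ⟨fun b => Ideal.Quotient.mk (varIdeal K T) (W' b), ?_⟩
  rw [scalarMatrix_mkQ, hW', hw']

/-- **The columns of `Φᵀ`**: `Σ_a Φ_{a b} • Σ_a = x_b • Σ_b − x_{a₀} • Σ_{a₀}`. -/
theorem sum_hbMatrix_transpose_smul (ha₀ : a₀ ∈ S) {M : Type u} [AddCommGroup M]
    [Module (MvPolynomial (Fin n) K) M] (σ : ↥S → M) (b : ↥(S.erase a₀)) :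
    ∑ a : ↥S, hbMatrix (K := K) S a₀ a b • σ a =
      (X (b : Fin n) : MvPolynomial (Fin n) K) • σ ⟨b.1, Finset.mem_of_mem_erase b.2⟩ -
        (X a₀ : MvPolynomial (Fin n) K) • σ ⟨a₀, ha₀⟩ := by
  have hb : (b : Fin n) ≠ a₀ := (Finset.mem_erase.1 b.2).1
  have hne : (⟨b.1, Finset.mem_of_mem_erase b.2⟩ : ↥S) ≠ ⟨a₀, ha₀⟩ := fun h => hb (congrArg Subtype.val h)
  rw [Finset.sum_eq_add_of_mem (⟨b.1, Finset.mem_of_mem_erase b.2⟩ : ↥S) ⟨a₀, ha₀⟩ (Finset.mem_univ _)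
    (Finset.mem_univ _) hne]
  · simp [hbMatrix, hb, sub_eq_add_neg]
  · intro a _ ha
    have h1 : (a : Fin n) ≠ a₀ := fun h => ha.2 (Subtype.ext h)
    have h2 : (b : Fin n) ≠ a := fun h => ha.1 (Subtype.ext h.symm)
    simp [hbMatrix, h1, h2]

/-- **Proportionality from the transpose relations** (over `R`): if `Σ_a Φ_{a b} Σ_a = 0` for every column `b` — i.e.
`x_b Σ_b = x_{a₀} Σ_{a₀}` for all `b ∈ S` — then `Σ_a = x_{S∖a} · r` for one `r` (the common value `x_a Σ_a` is
divisible by every `x_a`, hence by `x_S`). -/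
theorem exists_eq_sq_mul_of_transpose_rel (ha₀ : a₀ ∈ S) (σ : ↥S → MvPolynomial (Fin n) K)
    (h : ∀ b : ↥(S.erase a₀), ∑ a : ↥S, hbMatrix (K := K) S a₀ a b • σ a = 0) :
    ∃ r : MvPolynomial (Fin n) K, ∀ a : ↥S, σ a = sq (S.erase a.1) * r := by
  -- the common value `v = x_a Σ_a`
  set v : MvPolynomial (Fin n) K := X a₀ * σ ⟨a₀, ha₀⟩ with hv
  have hcommon : ∀ a : ↥S, X a.1 * σ a = v := by
    intro a
    by_cases ha : (a : Fin n) = a₀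
    · have : a = ⟨a₀, ha₀⟩ := Subtype.ext ha
      rw [this]
    · have hb : (a : Fin n) ∈ S.erase a₀ := Finset.mem_erase.2 ⟨ha, a.2⟩
      have := h ⟨a.1, hb⟩
      rw [sum_hbMatrix_transpose_smul S ha₀, sub_eq_zero, smul_eq_mul, smul_eq_mul] at this
      have ha' : (⟨a.1, Finset.mem_of_mem_erase hb⟩ : ↥S) = a := Subtype.ext rfl
      rw [ha'] at this
      rw [this]
  -- `v` is divisible by `x_S`
  have hdiv : ∀ e ∈ v.support, ind S ≤ e := by
    intro e he
    refine ind_le_iff.2 fun c hc => ?_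
    rw [← hcommon ⟨c, hc⟩, support_X_mul, Finset.mem_map] at he
    obtain ⟨e', -, rfl⟩ := he
    simp only [addLeftEmbedding_apply, Finsupp.mem_support_iff, Finsupp.coe_add, Pi.add_apply,
      Finsupp.single_eq_same]
    omega
  refine ⟨v.divMonomial (ind S), fun a => ?_⟩
  have hF : v = sq S * v.divMonomial (ind S) := eq_sq_mul_divMonomial hdiv
  have key : X a.1 * σ a = X a.1 * (sq (S.erase a.1) * v.divMonomial (ind S)) := by
    rw [hcommon a, ← mul_assoc, X_mul_sq_erase a.2]
    exact hF
  exact X_mul_cancel_left_iff.1 key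

/-- The cokernel `C = R̄^S ⧸ range Φ̄` (`= I_S ⊗_R R̄`). -/
noncomputable abbrev quotCokernel : Type u :=
  (↥S → MvPolynomial (Fin n) K ⧸ varIdeal K T) ⧸
    LinearMap.range (scalarMatrix (MvPolynomial (Fin n) K ⧸ varIdeal K T) (hbMatrix (K := K) S a₀))

/-- The transpose `Φᵀ` on `C`-valued vectors: `C^S → C^{S∖a₀}`. -/
noncomputable abbrev transposeOnCokernel :
    (↥S → quotCokernel (K := K) S (a₀ := a₀) T) →ₗ[MvPolynomial (Fin n) K]
      (↥(S.erase a₀) → quotCokernel (K := K) S (a₀ := a₀) T) :=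
  scalarMatrix (quotCokernel (K := K) S (a₀ := a₀) T) (fun b a => hbMatrix (K := K) S a₀ a b)

/-- The core map `R̄ → C^S`, `p̄ ↦ (a ↦ [p̄ e_a])`. -/
noncomputable def coreMidMap :
    (MvPolynomial (Fin n) K ⧸ varIdeal K T) →ₗ[MvPolynomial (Fin n) K] (↥S → quotCokernel (K := K) S (a₀ := a₀) T) :=
  LinearMap.pi fun a =>
    (LinearMap.range (scalarMatrix (MvPolynomial (Fin n) K ⧸ varIdeal K T) (hbMatrix (K := K) S a₀))).mkQ ∘ₗ
      LinearMap.single (MvPolynomial (Fin n) K) (fun _ : ↥S => MvPolynomial (Fin n) K ⧸ varIdeal K T) a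

/-- The components of the core map. -/
theorem coreMidMap_apply (p : MvPolynomial (Fin n) K ⧸ varIdeal K T) (a : ↥S) :
    coreMidMap (K := K) S (a₀ := a₀) T p a = Submodule.Quotient.mk (Pi.single a p) := rfl

/-- `Σ_a Φ_{a b} • e_a p̄ = Φ̄ (e_b p̄)`: the columns of `Φᵀ` applied to unit vectors are in the range of `Φ̄`. -/
theorem sum_hbMatrix_smul_single (p : MvPolynomial (Fin n) K ⧸ varIdeal K T) (b : ↥(S.erase a₀)) :
    ∑ a : ↥S, hbMatrix (K := K) S a₀ a b • (Pi.single a p : ↥S → MvPolynomial (Fin n) K ⧸ varIdeal K T) =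
      scalarMatrix (MvPolynomial (Fin n) K ⧸ varIdeal K T) (hbMatrix (K := K) S a₀) (Pi.single b p) := by
  funext a
  rw [Finset.sum_apply, scalarMatrix_apply, Finset.sum_eq_single a, Finset.sum_eq_single b]
  · simp
  · intro b' _ hb'; simp [hb']
  · intro hb; exact absurd (Finset.mem_univ b) hb
  · intro a' _ ha'; simp [ha']
  · intro ha; exact absurd (Finset.mem_univ a) ha

/-- The core map lands in `ker Φᵀ`. -/
theorem transposeOnCokernel_coreMidMap (p : MvPolynomial (Fin n) K ⧸ varIdeal K T) :
    transposeOnCokernel (K := K) S T (coreMidMap (K := K) S (a₀ := a₀) T p) = 0 := by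
  funext b
  rw [scalarMatrix_apply, Pi.zero_apply]
  simp only [coreMidMap_apply]
  rw [← map_sum_smul_mk]
  · rw [sum_hbMatrix_smul_single, Submodule.Quotient.mk_eq_zero]
    exact ⟨_, rfl⟩
where
  /-- `Σ c_a • [v_a] = [Σ c_a • v_a]` in a quotient module. -/
  map_sum_smul_mk {P : Type u} [AddCommGroup P] [Module (MvPolynomial (Fin n) K) P]
      {U : Submodule (MvPolynomial (Fin n) K) P} {α : Type} [Fintype α] (c : α → MvPolynomial (Fin n) K)
      (v : α → P) :
      (Submodule.Quotient.mk (∑ a, c a • v a) : P ⧸ U) = ∑ a, c a • Submodule.Quotient.mk (v a) := by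
    rw [← Submodule.mkQ_apply, map_sum]
    simp

/-- **The core map is injective** (`S ∩ T = ∅`): apply `ḡs`, which kills `range Φ̄`, to `[p̄ e_a] = 0`:
`x_{S∖a} p̄ = 0` in `R̄`, and `x_{S∖a}` is a non-zero-divisor modulo `J`. -/
theorem coreMidMap_injective (ha₀ : a₀ ∈ S) (hST : ∀ a ∈ S, a ∉ T) :
    Function.Injective (coreMidMap (K := K) S (a₀ := a₀) T) := by
  rw [← LinearMap.ker_eq_bot, Submodule.eq_bot_iff]
  intro p hp
  rw [LinearMap.mem_ker] at hp
  have ha := congr_fun hp ⟨a₀, ha₀⟩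
  rw [coreMidMap_apply, Pi.zero_apply, Submodule.Quotient.mk_eq_zero] at ha
  obtain ⟨w, hw⟩ := ha
  have h1 := congrArg (genMapQuot S T) hw
  rw [genMapQuot_scalarMatrix S T ha₀, genMapQuot_apply, Finset.sum_eq_single ⟨a₀, ha₀⟩] at h1
  · rw [Pi.single_eq_same] at h1
    exact sq_smul_quot_injective T (fun u hu => hST u (Finset.mem_of_mem_erase hu)) (by
      change (sq (S.erase a₀) : MvPolynomial (Fin n) K) • p = (sq (S.erase a₀) : MvPolynomial (Fin n) K) • 0
      rw [smul_zero]; exact h1.symm)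
  · intro a _ ha
    rw [Pi.single_eq_of_ne ha, smul_zero]
  · intro h; exact absurd (Finset.mem_univ _) h

/-- **The core map is onto `ker Φᵀ`** (`S ∩ T = ∅`): for `c ∈ ker Φᵀ` with lifts `v_a ∈ R̄^S`, the values
`s_a = ḡs(v_a)` satisfy the transpose relations, hence (by `T`-free lifting and `exists_eq_sq_mul_of_transpose_rel`)
`s_a = x_{S∖a} p̄`; then `v_a − p̄ e_a ∈ ker ḡs = range Φ̄`. -/
theorem exists_coreMidMap_eq (ha₀ : a₀ ∈ S) (hST : ∀ a ∈ S, a ∉ T)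
    (c : ↥S → quotCokernel (K := K) S (a₀ := a₀) T) (hc : transposeOnCokernel (K := K) S T c = 0) :
    ∃ p, coreMidMap (K := K) S (a₀ := a₀) T p = c := by
  -- lifts `v_a ∈ R̄^S` of the classes `c_a`
  have hv : ∀ a, ∃ v : ↥S → MvPolynomial (Fin n) K ⧸ varIdeal K T, Submodule.Quotient.mk v = c a :=
    fun a => Submodule.Quotient.mk_surjective _ (c a)
  choose v hv using hv
  -- the values `s_a = ḡs(v_a)` and `T`-free lifts `Σ_a`
  have hg0 : ∀ a, ∃ g : MvPolynomial (Fin n) K, (∀ e ∈ g.support, ¬ Touches T e) ∧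
      Ideal.Quotient.mk (varIdeal K T) g = genMapQuot S T (v a) := fun a => exists_tfree_rep T _
  choose g hgfree hg using hg0
  -- the transpose relations hold for `s`, hence (T-freeness) for the lifts `g` in `R`
  have hrelbar : ∀ b : ↥(S.erase a₀), ∑ a : ↥S, hbMatrix (K := K) S a₀ a b • genMapQuot S T (v a) = 0 := by
    intro b
    have hb := congr_fun hc b
    rw [scalarMatrix_apply, Pi.zero_apply] at hb
    have : (∑ a : ↥S, hbMatrix (K := K) S a₀ a b • c a) =
        Submodule.Quotient.mk (∑ a : ↥S, hbMatrix (K := K) S a₀ a b • v a) := by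
      rw [← Submodule.mkQ_apply, map_sum]
      simp [hv]
    rw [this, Submodule.Quotient.mk_eq_zero] at hb
    obtain ⟨w, hw⟩ := hb
    have h1 := congrArg (genMapQuot S T) hw
    rw [genMapQuot_scalarMatrix S T ha₀, map_sum] at h1
    simp only [map_smul] at h1
    exact h1.symm
  have hrel : ∀ b : ↥(S.erase a₀), ∑ a : ↥S, hbMatrix (K := K) S a₀ a b • g a = 0 := by
    intro b
    apply eq_zero_of_tfree_of_mem T
    · refine tfree_sum T _ _ fun a _ => ?_
      rw [smul_eq_mul]
      refine tfree_mul T ?_ (hgfree a)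
      unfold hbMatrix
      split_ifs
      · exact tfree_neg T (tfree_X T (hST a₀ ha₀))
      · exact tfree_X T (hST a a.2)
      · exact tfree_zero T
    · rw [← Ideal.Quotient.eq_zero_iff_mem, map_sum]
      simp only [smul_eq_mul, map_mul, ← hrelbar b]
      refine Finset.sum_congr rfl fun a _ => ?_
      obtain ⟨y, hy⟩ := Ideal.Quotient.mk_surjective (genMapQuot S T (v a))
      rw [hg a, ← hy, smul_mk_eq, map_mul]
  obtain ⟨r, hr⟩ := exists_eq_sq_mul_of_transpose_rel S ha₀ g hrel
  refine ⟨Ideal.Quotient.mk (varIdeal K T) r, ?_⟩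
  funext a
  rw [coreMidMap_apply, ← hv a, Submodule.Quotient.eq]
  -- `p̄ e_a − v_a ∈ ker ḡs = range Φ̄`
  have hker : genMapQuot S T (Pi.single a (Ideal.Quotient.mk (varIdeal K T) r) - v a) = 0 := by
    rw [map_sub, genMapQuot_apply, Finset.sum_eq_single a, Pi.single_eq_same, ← hg a, hr a, smul_mk_eq,
      mul_comm, sub_self]
    · intro a' _ ha'
      rw [Pi.single_eq_of_ne ha', smul_zero]
    · intro h; exact absurd (Finset.mem_univ a) h
  obtain ⟨w', hw'⟩ := exists_scalarMatrix_eq_of_genMapQuot_eq_zero S T ha₀ hST _ hker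
  exact ⟨w', hw'⟩

/-- **THE CORE OF §6.B(c) IN A MIDDLE DEGREE: `R̄ ≃ₗ[R] ker(Φᵀ on (R̄^S ⧸ range Φ̄)-valued vectors)`**, `R̄ = R ⧸ J`,
`J = (x_t : t ∈ T)`, `S ∩ T = ∅` — in words `ker(Φᵀ ⊗ 1 on (I_S ⊗ R̄)^S) = Hom_R(I_S, I_S) ⊗ R̄ = R̄`: the Hom-dual
of the Hilbert–Burch presentation of `I_S` stays exact at its left end after reduction modulo the variables of the other
blocks. -/
noncomputable def kerTransposeEquiv (ha₀ : a₀ ∈ S) (hST : ∀ a ∈ S, a ∉ T) :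
    (MvPolynomial (Fin n) K ⧸ varIdeal K T) ≃ₗ[MvPolynomial (Fin n) K]
      ↥(LinearMap.ker (transposeOnCokernel (K := K) S (a₀ := a₀) T)) :=
  LinearEquiv.ofBijective
    (LinearMap.codRestrict _ (coreMidMap (K := K) S (a₀ := a₀) T) fun p =>
      LinearMap.mem_ker.2 (transposeOnCokernel_coreMidMap S T p))
    ⟨fun p q h => coreMidMap_injective S T ha₀ hST (congrArg Subtype.val h),
      fun c => by
        obtain ⟨p, hp⟩ := exists_coreMidMap_eq S T ha₀ hST c.1 (LinearMap.mem_ker.1 c.2)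
        exact ⟨p, Subtype.ext hp⟩⟩

end Core

end Summit.Ventures.HSemireg.ObstructionLocus.BlockModel
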